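import Summits.BirchSwinnertonDyer.BirchSwinnertonDyer.Theorems.UniversalToricDescentSigmaLocalFinite
import HarnessLib

/-!
# Route UniversalToricDescent — the local exponent is at most two: `#H¹(H ∩ D_v, E[p^∞])[p] ≤ p²`,
# so `s_v ∈ {0, 1, 2}` in `λ_alg(E) + Σ_{v∈Σ} 3^{c_v} s_v(E) = n′ + Σ_{v∈Σ} 3^{c_v} s_v(E′)`

Lead prover bsd-wall-utd-p1 g8 (`--supports stmt-BirchSwinnertonDyer-20399`; memo ALG-HALF-21845-LOCAL §3,
the first a-priori control of the local terms). At a place `v ∤ p` finitely decomposed in `K_∞`: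

* §1 `natCard_subgroupH1_inf_decomp_geomTorsion_le` — **`#H¹(ker κ ⊓ D_v, E[p]) ≤ p²`**: the tree's
  prime-to-`p` tower bound `#H¹(Gal(K̄_v/K_{∞,η}), B) ≤ #B` (`Iwasawa.NonsplitTower.finite_subgroupH1_and_natCard_le`,
  Greenberg LNM 1716 §3 / Coates Lemma 3.8) for `B = E[p]` (`#E[p] = p²`, prime to the residue
  characteristic), moved to the global group by the injective inflation along
  `Gal(K̄_v/K_{∞,η}) ↠ ker κ ⊓ D_v` (as in `UniversalToricDescentSigmaPassage`, which kept only finiteness).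
* §2 `natCard_pTorsion_subgroupH1_kerD_le` — **`#H¹(H ∩ D_v, E[p^∞])[p] ≤ p²`** (kerD currency): the
  `p`-torsion injects into `H¹(ker κ ⊓ D_v, E[p^∞])[p]` (`exists_injective_subgroupH1_kerD`), onto which
  `H¹(ker κ ⊓ D_v, E[p])` surjects by the Kummer lift (`exists_torsionToPrimaryH1Sub_eq`);
  `exists_natCard_pTorsion_subgroupH1_kerD_eq_pow_le_two` — hence `= p^{s_v}` with `s_v ≤ 2`
  (Greenberg–Vatsal: `s_v = corank_{ℤ_p} H¹(K_{∞,w_v}, E[p^∞]) ≤ 2`).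

HONEST STATUS: helper theorems; the exact value of `s_v` (GV Prop. 2.4) is not computed. THEOREMS ONLY;
no definition, no named fact, no `sorry`. BSD is not advanced by this file.
References: [GreenbergVatsal2000] §2 Prop. (2.4) (p. 24); [GreenbergLNM1716] §3 Lemma 3.3 (p. 87),
Coates §3 Lemma 3.8.
-/

set_option autoImplicit false
-- `…BirchSwinnertonDyer.BirchSwinnertonDyer.Theorems…` is the problem's mandated namespace (D-0017).
set_option linter.dupNamespace false

noncomputable section

open scoped Classical

namespace Summit.BirchSwinnertonDyer.BirchSwinnertonDyer.Theorems.UniversalToricDescentSigmaLocalImage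

open NumberField IsDedekindDomain Field
open Literature.NumberTheory.EllipticCurves Literature.NumberTheory.EllipticCurves.GreenbergSelmer
  Literature.NumberTheory.GaloisRepresentations WeierstrassCurve
  Summit.BirchSwinnertonDyer.Rank1Residual.X11b Summit.BirchSwinnertonDyer.Rank1Residual.X11b.Coinv
  Summit.BirchSwinnertonDyer.Rank1Residual.X11b.AcSelmer Summit.BirchSwinnertonDyer.Rank1Residual.Iwasawa
  Summit.BirchSwinnertonDyer.BirchSwinnertonDyer.Theorems.UniversalToricDescentSigmaPassage

variable {K : Type} [Field K] [NumberField K] (W : WeierstrassCurve K) [W.IsElliptic] {p : ℕ}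
  [Fact p.Prime] (κ : ZpExtension K p)

/-! ### §1 `#H¹(ker κ ⊓ D_v, E[p]) ≤ p²` -/

-- adapted from `UniversalToricDescentSigmaPassage.finite_subgroupH1_inf_decomp_geomTorsion` (g6), keeping
-- the cardinality half of the tower theorem.
/-- **`#H¹(Gal(K̄/K_∞) ⊓ D_v, E[p]) ≤ p²`** at a place `v ∤ p` finitely decomposed in `K_∞`: the local
bound `#H¹(Gal(K̄_v/K_{∞,η}), E[p]) ≤ #E[p] = p²` (prime-to-`p` tower over inertia) transported along the
injective inflation. [cite: GreenbergLNM1716, §3 Lemma 3.3 (proof, p. 87)] [cite: GreenbergVatsal2000, §2 Prop. (2.4)] -/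
theorem natCard_subgroupH1_inf_decomp_geomTorsion_le {v : HeightOneSpectrum (𝓞 K)}
    (hpv : (p : 𝓞 K) ∉ v.asIdeal) (hv : ¬ (decomp v ≤ κ.kerSubgroup)) :
    Nat.card (Literature.NumberTheory.EllipticCurves.subgroupH1 (κ.kerSubgroup ⊓ decomp v)
      (W.geomTorsion (p : ℤ))) ≤ p ^ 2 := by
  have hp : p.Prime := Fact.out
  letI : DistribMulAction (absoluteGaloisGroup (v.adicCompletion K)) (W.geomTorsion (p : ℤ)) :=
    DistribMulAction.compHom _ (absGaloisRestrict K (v.adicCompletion K)).toMonoidHom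
  haveI : ContinuousSMul (absoluteGaloisGroup K) (W.geomTorsion (p : ℤ)) :=
    WeierstrassCurve.continuousSMul_geomTorsion W (WeierstrassCurve.isOpen_stabilizer_point_holds W) _
  have hcont : ∀ b : W.geomTorsion (p : ℤ),
      Continuous fun σ : absoluteGaloisGroup (v.adicCompletion K) ↦ σ • b := fun b ↦ by
    change Continuous fun σ : absoluteGaloisGroup (v.adicCompletion K) ↦
      absGaloisRestrict K (v.adicCompletion K) σ • b
    exact (continuous_id.smul continuous_const :
      Continuous fun τ : absoluteGaloisGroup K ↦ τ • b).comp
        (absGaloisRestrict K (v.adicCompletion K)).continuous_toFun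
  have hns : ∃ σ : absoluteGaloisGroup (v.adicCompletion K),
      σ ∉ localSubgroup κ.kerSubgroup (v.adicCompletion K) := by
    by_contra hall
    refine hv fun g hg ↦ ?_
    obtain ⟨σ, rfl⟩ := (mem_decomp_iff v g).mp hg
    have hσ : σ ∈ localSubgroup κ.kerSubgroup (v.adicCompletion K) :=
      not_not.mp fun h ↦ hall ⟨σ, h⟩
    have h := (mem_localSubgroup_iff κ.kerSubgroup (v.adicCompletion K) σ).mp hσ
    rwa [resGal_eq_absGaloisRestrict] at h
  haveI : Finite (W.geomTorsion (p : ℤ)) :=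
    WeierstrassCurve.finite_torsionPoints_holds W (AlgebraicClosure K) (by exact_mod_cast hp.ne_zero)
  have hcard : Nat.card (W.geomTorsion (p : ℤ)) = p ^ 2 :=
    WeierstrassCurve.card_torsionPoints_eq_sq_holds W (AlgebraicClosure K) (by
      haveI : CharZero (AlgebraicClosure K) :=
        charZero_of_injective_algebraMap (algebraMap K (AlgebraicClosure K)).injective
      exact_mod_cast hp.ne_zero)
  have hℓ := ringChar_residueField_prime (F := v.adicCompletion K)
  have hne := v.ringChar_residueField_adicCompletion_ne hpv
  have hB : ∃ k : ℕ, ∀ b : W.geomTorsion (p : ℤ), p ^ k • b = 0 := ⟨1, fun b ↦ by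
    rw [pow_one]
    exact Subtype.ext (by
      rw [AddSubgroupClass.coe_nsmul, ZeroMemClass.coe_zero, ← natCast_zsmul]
      exact (mem_geomTorsion_iff W (p : ℤ) _).mp b.2)⟩
  obtain ⟨hfin, hle⟩ := NonsplitTower.finite_subgroupH1_and_natCard_le κ hpv hns hB (by
    rw [hcard]
    exact ((Nat.coprime_primes hp hℓ).2 (Ne.symm hne)).pow_left 2) hcont
  -- inflation along `Gal(K̄_v/K_{∞,η}) ↠ ker κ ⊓ D_v`
  let θ : localSubgroup κ.kerSubgroup (v.adicCompletion K) →ₜ* (κ.kerSubgroup ⊓ decomp v :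
      Subgroup (absoluteGaloisGroup K)) :=
    { toFun := fun x ↦ ⟨absGaloisRestrict K (v.adicCompletion K) x, Subgroup.mem_inf.mpr ⟨by
          have h := (mem_localSubgroup_iff κ.kerSubgroup (v.adicCompletion K) x.1).mp x.2
          rwa [resGal_eq_absGaloisRestrict] at h, (mem_decomp_iff v _).mpr ⟨x, rfl⟩⟩⟩
      map_one' := Subtype.ext (by simp)
      map_mul' := fun x y ↦ Subtype.ext (by simp)
      continuous_toFun :=
        ((absGaloisRestrict K (v.adicCompletion K)).continuous_toFun.comp
          continuous_subtype_val).subtype_mk _ }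
  have hθ : Function.Surjective θ := by
    rintro ⟨g, hg⟩
    obtain ⟨hgH, hgD⟩ := Subgroup.mem_inf.mp hg
    obtain ⟨σ, rfl⟩ := (mem_decomp_iff v g).mp hgD
    have hσ : σ ∈ localSubgroup κ.kerSubgroup (v.adicCompletion K) := by
      rw [mem_localSubgroup_iff, resGal_eq_absGaloisRestrict]; exact hgH
    exact ⟨⟨σ, hσ⟩, rfl⟩
  haveI := hfin
  rw [← hcard]
  exact (Nat.card_le_card_of_injective _ (resH1Hom_injective_of_surjective θ hθ fun _ _ ↦ rfl)).trans hle

/-! ### §2 `#H¹(H ∩ D_v, E[p^∞])[p] ≤ p²`, i.e. `s_v ≤ 2` -/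

/-- **`#H¹(H ∩ D_v, E[p^∞])[p] ≤ p²`** at a place `v ∤ p` finitely decomposed in `K_∞` (kerD currency):
the `p`-torsion injects into `H¹(ker κ ⊓ D_v, E[p^∞])[p]`, a quotient of `H¹(ker κ ⊓ D_v, E[p])` by the
Kummer lift, which has at most `p²` elements. [cite: GreenbergVatsal2000, §2 Prop. (2.4) (p. 24)]
[cite: GreenbergLNM1716, §3 Lemma 3.3 (proof, p. 87)] -/
theorem natCard_pTorsion_subgroupH1_kerD_le {v : HeightOneSpectrum (𝓞 K)} (hpv : (p : 𝓞 K) ∉ v.asIdeal)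
    (hv : ¬ (decomp v ≤ κ.kerSubgroup)) :
    Nat.card {f : subgroupH1 (kerD κ v) (W.geomPrimaryTorsion p) // p • f = 0} ≤ p ^ 2 := by
  haveI := finite_subgroupH1_inf_decomp_geomTorsion W κ hpv hv
  haveI := (finite_pTorsion_subgroupH1_inf_decomp W κ hpv hv).to_subtype
  -- (a) into the `ker κ ⊓ D_v` currency
  obtain ⟨ρ, hρ⟩ := exists_injective_subgroupH1_kerD κ (M := W.geomPrimaryTorsion p) v
  let j : {f : subgroupH1 (kerD κ v) (W.geomPrimaryTorsion p) // p • f = 0} →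
      {c : W.subgroupH1 p (κ.kerSubgroup ⊓ decomp v) | p • c = 0} :=
    fun f ↦ ⟨ρ f.1, by
      show p • ρ f.1 = 0
      rw [← map_nsmul, f.2, map_zero]⟩
  have hj : Function.Injective j := fun a b h ↦ Subtype.ext (hρ (congrArg Subtype.val h))
  -- (b) the Kummer lift is onto the `p`-torsion: choose preimages
  have hex : ∀ c : {c : W.subgroupH1 p (κ.kerSubgroup ⊓ decomp v) | p • c = 0},
      ∃ y : Literature.NumberTheory.EllipticCurves.subgroupH1 (κ.kerSubgroup ⊓ decomp v)
        (W.geomTorsion (p : ℤ)), W.torsionToPrimaryH1Sub p (κ.kerSubgroup ⊓ decomp v) y = c :=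
    fun c ↦ W.exists_torsionToPrimaryH1Sub_eq p W.zsmul_geomPoints_surjective_holds c.2
  choose g hg using hex
  have hginj : Function.Injective g := fun a b h ↦ Subtype.ext (by rw [← hg a, ← hg b, h])
  calc Nat.card {f : subgroupH1 (kerD κ v) (W.geomPrimaryTorsion p) // p • f = 0}
      ≤ Nat.card {c : W.subgroupH1 p (κ.kerSubgroup ⊓ decomp v) | p • c = 0} :=
        Nat.card_le_card_of_injective j hj
    _ ≤ Nat.card (Literature.NumberTheory.EllipticCurves.subgroupH1 (κ.kerSubgroup ⊓ decomp v)
          (W.geomTorsion (p : ℤ))) := Nat.card_le_card_of_injective g hginj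
    _ ≤ p ^ 2 := natCard_subgroupH1_inf_decomp_geomTorsion_le W κ hpv hv

/-- **`#H¹(H ∩ D_v, E[p^∞])[p] = p^{s_v}` with `s_v ≤ 2`.** [cite: GreenbergVatsal2000, §2 Prop. (2.4) (p. 24)] -/
theorem exists_natCard_pTorsion_subgroupH1_kerD_eq_pow_le_two {v : HeightOneSpectrum (𝓞 K)}
    (hpv : (p : 𝓞 K) ∉ v.asIdeal) (hv : ¬ (decomp v ≤ κ.kerSubgroup)) :
    ∃ s : ℕ, s ≤ 2 ∧
      Nat.card {f : subgroupH1 (kerD κ v) (W.geomPrimaryTorsion p) // p • f = 0} = p ^ s := by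
  obtain ⟨s, hs⟩ := exists_natCard_pTorsion_subgroupH1_kerD_eq_pow W κ hpv hv
  refine ⟨s, ?_, hs⟩
  have h := natCard_pTorsion_subgroupH1_kerD_le W κ hpv hv
  rw [hs] at h
  exact (Nat.pow_le_pow_iff_right (Fact.out : p.Prime).one_lt).mp h

end Summit.BirchSwinnertonDyer.BirchSwinnertonDyer.Theorems.UniversalToricDescentSigmaLocalImage

end
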